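import Literature.NumberTheory.GaloisRepresentations.LubinTateNormGroup
import Literature.NumberTheory.GaloisRepresentations.LubinTateCharacter
import HarnessLib

/-!
# De Shalit's (2) in relative form: values of `𝒩`-iterates are relative norms along the tower

De Shalit, *Iwasawa theory of elliptic curves with complex multiplication* (1987), Ch. I §2.2 (proof of
the Theorem, formula (2)): for `h ∈ 𝒪'⟦X⟧` and the generator `(ω_i)` of the Tate module,
`(𝒩^{(m-n)} h)(ω_n) = ∏_{α ∈ W_f^{m-n}} h(ω_m [+] α) = N_{m,n}(h(ω_m))`, the norm from `k_π^m` to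
`k_π^n`. In particular (Cor. 2.3 (ii) read backwards) **if `𝒩h = h` then `(h(ω_n))_n` is a
norm-coherent sequence** — the easy half of the correspondence between `𝒩`-invariant power series
and norm-coherent sequences of units (Coleman 1979 Thm. A).

Everything here happens INSIDE one Lubin–Tate field `E = K_π^{m+1} = F(λ_{m+1})` (`ltField π m`) for
`f = πX + X^q` over a non-archimedean local field `F`: a primitive division point is `ω = [u] λ_{m+1}`
(`u ∈ 𝒪_Fˣ`), the lower levels are the `[π^k] ω` (`k ≤ m`, a primitive point of level `m+1-k`), and the
relative norm from `E` to `F([π^k] ω) = K_π^{m+1-k}` of `y ∈ E` is the product of `σ y` over the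
STABILISER `{σ ∈ Gal(E/F) : σ([π^k] ω) = [π^k] ω}` (= `Gal(E/F([π^k]ω))`). Everything **proved**:

* `galOfUnit` — for a unit `v`, the automorphism `σ_v` with `σ_v λ = [v] λ` (the inverse of the tree's
  `ltGalCharEquiv : Gal(E/F) ≃* (𝒪_F/π^{m+1})ˣ`), `mapPt_galOfUnit_genPt`; `algEquiv_eq_of_mapPt_genPt_eq`
  (an automorphism is determined by `σ λ`).
* `stabParam` — **the parametrisation of the stabiliser**: `e ∈ 𝓀^k ↦ σ_e` with
  `σ_e ω = ω [+] [π^{m+1-k} Σ digit(eᵢ) πⁱ] λ` (`mapPt_stabParam`), `σ_e` fixes `[π^k] ω`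
  (`mapPt_stabParam_ltAct_pow`), `e ↦ σ_e` is injective (`stabParam_injective`) and exhausts the
  stabiliser (`exists_stabParam_eq_of_mapPt_eq`).
* ★ `prod_stabilizer_algEquiv_evalAt` — **`∏_{σ : σ[π^k]ω = [π^k]ω} σ(h(ω)) = (𝒩^{(k)} h)([π^k] ω)`**
  for every `h ∈ 𝒪_F⟦X⟧`, `k ≤ m` (de Shalit's (2): the product over the stabiliser is the Coleman
  product `∏_{α ∈ W_f^k} h(ω [+] α)`, which is the tree's `evalAt_ltSMul_pow_colemanNormIter`,
  de Shalit I §2.1 (iii)).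
* `prod_stabilizer_algEquiv_evalAt_of_colemanNorm_eq` — **for `𝒩h = h`: `∏_{σ} σ(h(ω)) = h([π^k] ω)`**,
  i.e. the values of an `𝒩`-invariant series at a generator of the Tate module are norm-coherent.

## References

* E. de Shalit, *Iwasawa theory of elliptic curves with complex multiplication* (1987), Ch. I §2.2,
  proof of the Theorem, (2); Cor. 2.3 (ii). [cite: deShalit1987, Ch. I §2.2 (2)]
* R. Coleman, *Division values in local fields*, Invent. Math. 53 (1979), Thm. A / Cor. 14.

## Mathlib reuse

`Finset.prod_bij`, `MulEquiv.symm_apply_apply`, `Valuation.map_add_eq_of_lt_left`,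
`Valuation.Integers.isUnit_iff_valuation_eq_one`; from the tree: `LubinTateCharacter.lean` (`ltAct`,
`ltGalUnit`, `mapPt_genPt`, `mapPt_ltAct'`, `ltGalCharEquiv`, `coe_ltGalChar_eq_iff`, `ltGalChar_injective`,
`ltAct_genPt_eq_iff`), `LubinTateNormOperator.lean` (`colemanNormIter`, `evalAt_ltSMul_pow_colemanNormIter`,
`exists_digits`), `LubinTateNormGroup.lean` (`digits_injective`), `LubinTateColemanNorm.lean`
(`algHom_evalAt`), `LubinTateTorsion.lean` (`toUnitBallHom`, `mapPt`, `genPt`).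
-/

noncomputable section

open Filter Topology Polynomial ValuativeRel
open scoped PowerSeries.WithPiTopology

namespace Literature.NumberTheory.GaloisRepresentations

section LocalFieldNC

open GaloisRepresentations.IsNonarchimedeanLocalField LubinTate

variable (F : Type*) [Field F] [ValuativeRel F] [TopologicalSpace F] [IsNonarchimedeanLocalField F]

attribute [local instance] ltNormUniformSpace ltNormIsUniformAddGroup rk1 nF nE fintypeResidueField

variable {F}
variable {π : 𝒪[F]} (hπ : (valuation F).IsUniformizer (π : F)) (m : ℕ)

/-! ### Automorphisms with prescribed action on `λ_{m+1}` -/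

/-- **The automorphism `σ_v` of `K_π^{m+1}/F` with `σ_v λ_{m+1} = [v] λ_{m+1}`** for a unit `v ∈ 𝒪_Fˣ`
(inverse of the Lubin–Tate character `ltGalCharEquiv`). [cite: CasselsFrohlichANT1967, Ch. VI §3.6 Prop. 6 (b)] -/
def galOfUnit (v : 𝒪[F]ˣ) : ltField π m ≃ₐ[F] ltField π m :=
  (ltGalCharEquiv hπ m).symm (unitsModPow π m v)

/-- `σ_v λ = [v] λ`. [cite: CasselsFrohlichANT1967, Ch. VI §3.6 Prop. 6 (b)] -/
theorem mapPt_galOfUnit_genPt (v : 𝒪[F]ˣ) :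
    mapPt (galOfUnit hπ m v) (genPt hπ m) = ltAct hπ m (v : 𝒪[F]) (genPt hπ m) := by
  refine (coe_ltGalChar_eq_iff hπ).mp ?_
  have h1 : ltGalChar hπ m (galOfUnit hπ m v) = unitsModPow π m v := by
    rw [galOfUnit, ← ltGalCharEquiv_apply, MulEquiv.apply_symm_apply]
  rw [h1]
  rfl

/-- **An automorphism of `K_π^{m+1}/F` is determined by its value on `λ_{m+1}`.**
[cite: CasselsFrohlichANT1967, Ch. VI §3.6 Prop. 6 (b)] -/
theorem algEquiv_eq_of_mapPt_genPt_eq {σ τ : ltField π m ≃ₐ[F] ltField π m}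
    (h : mapPt σ (genPt hπ m) = mapPt τ (genPt hπ m)) : σ = τ := by
  refine ltGalChar_injective hπ m (Units.ext ?_)
  rw [coe_ltGalChar hπ m τ]
  exact (coe_ltGalChar_eq_iff hπ).mpr (h.trans (mapPt_genPt hπ m τ))

/-- An automorphism is determined by its value on any primitive point `[u] λ_{m+1}`, `u` a unit.
[cite: CasselsFrohlichANT1967, Ch. VI §3.6 Prop. 6 (b)] -/
theorem algEquiv_eq_of_mapPt_ltAct_eq (u : 𝒪[F]ˣ) {σ τ : ltField π m ≃ₐ[F] ltField π m}
    (h : mapPt σ (ltAct hπ m (u : 𝒪[F]) (genPt hπ m)) = mapPt τ (ltAct hπ m (u : 𝒪[F]) (genPt hπ m))) :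
    σ = τ := by
  refine algEquiv_eq_of_mapPt_genPt_eq hπ m ?_
  have h1 := congrArg (ltAct hπ m ((u⁻¹ : 𝒪[F]ˣ) : 𝒪[F])) h
  rwa [← mapPt_ltAct', ← mapPt_ltAct', ← ltAct_mul, Units.inv_mul, ltAct_one] at h1

/-! ### The parametrisation of the stabiliser of `[π^k] ω` by `𝓀^k` -/

variable (u : 𝒪[F]ˣ) {k : ℕ}

include hπ in
/-- `u + π^{m+1-k} D` is a unit for `k ≤ m`. [cite: SerreLocalFields1979, Ch. I §1] -/
theorem isUnit_add_pow_mul (hk : k ≤ m) (D : 𝒪[F]) : IsUnit ((u : 𝒪[F]) + π ^ (m + 1 - k) * D) := by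
  rw [Valuation.Integers.isUnit_iff_valuation_eq_one (Valuation.integer.integers (valuation F))]
  have hu : valuation F ((u : 𝒪[F]) : F) = 1 :=
    (Valuation.Integers.isUnit_iff_valuation_eq_one (Valuation.integer.integers (valuation F))).mp
      u.isUnit
  have hlt : valuation F (((π ^ (m + 1 - k) * D : 𝒪[F]) : F)) < valuation F ((u : 𝒪[F]) : F) := by
    rw [hu, Subring.coe_mul, SubmonoidClass.coe_pow, map_mul, map_pow]
    calc valuation F (π : F) ^ (m + 1 - k) * valuation F (D : F)
        ≤ valuation F (π : F) ^ (m + 1 - k) * 1 := by gcongr; exact D.2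
      _ < 1 := by
        rw [mul_one]
        exact pow_lt_one₀ zero_le hπ.val_lt_one (by omega)
  change valuation F (((u : 𝒪[F]) : F) + ((π ^ (m + 1 - k) * D : 𝒪[F]) : F)) = 1
  rw [(valuation F).map_add_eq_of_lt_left hlt, hu]

/-- **The stabiliser parametrisation** `e ↦ σ_e`: `σ_e` is the automorphism with
`σ_e λ = [(u + π^{m+1-k} Σ digit(eᵢ) πⁱ) u⁻¹] λ`, so that `σ_e ω = ω [+] [π^{m+1-k} Σ digit(eᵢ) πⁱ] λ` for
`ω = [u] λ`. [cite: deShalit1987, Ch. I §2.2 (2)] -/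
def stabParam (hk : k ≤ m) (e : Fin k → 𝓀[F]) : ltField π m ≃ₐ[F] ltField π m :=
  galOfUnit hπ m ((isUnit_add_pow_mul hπ m u hk (digitSum (π := π) (residueDigit F) e)).unit * u⁻¹)

/-- `σ_e ω = [u + π^{m+1-k} Σ digit(eᵢ) πⁱ] λ` for `ω = [u] λ`. [cite: deShalit1987, Ch. I §2.2 (2)] -/
theorem mapPt_stabParam_eq_ltAct (hk : k ≤ m) (e : Fin k → 𝓀[F]) :
    mapPt (stabParam hπ m u hk e) (ltAct hπ m (u : 𝒪[F]) (genPt hπ m)) =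
      ltAct hπ m ((u : 𝒪[F]) + π ^ (m + 1 - k) * digitSum (π := π) (residueDigit F) e) (genPt hπ m) := by
  rw [mapPt_ltAct', stabParam, mapPt_galOfUnit_genPt, ← ltAct_mul, Units.val_mul, IsUnit.unit_spec,
    ← mul_assoc, mul_comm (u : 𝒪[F]), mul_assoc, Units.mul_inv, mul_one]

/-- **`σ_e ω = ω [+] [π^{m+1-k} Σ digit(eᵢ) πⁱ] λ`.** [cite: deShalit1987, Ch. I §2.2 (2)] -/
theorem mapPt_stabParam (hk : k ≤ m) (e : Fin k → 𝓀[F]) :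
    mapPt (stabParam hπ m u hk e) (ltAct hπ m (u : 𝒪[F]) (genPt hπ m)) =
      ltAdd (maxNilIdeal F (ltField π m)) (isLTRing_LTCoeff hπ) (isLTSeries_LTCoeff π)
        (ltAct hπ m (u : 𝒪[F]) (genPt hπ m))
        (ltAct hπ m (π ^ (m + 1 - k) * digitSum (π := π) (residueDigit F) e) (genPt hπ m)) := by
  rw [mapPt_stabParam_eq_ltAct, ltAct, map_add, add_ltSMul]

/-- **`σ_e` fixes `[π^k] ω`** (`[π^k](u + π^{m+1-k}D) ≡ π^k u (mod π^{m+1})`).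
[cite: deShalit1987, Ch. I §2.2 (2)] -/
theorem mapPt_stabParam_ltAct_pow (hk : k ≤ m) (e : Fin k → 𝓀[F]) :
    mapPt (stabParam hπ m u hk e) (ltAct hπ m (π ^ k) (ltAct hπ m (u : 𝒪[F]) (genPt hπ m))) =
      ltAct hπ m (π ^ k) (ltAct hπ m (u : 𝒪[F]) (genPt hπ m)) := by
  rw [mapPt_ltAct', mapPt_stabParam_eq_ltAct, ← ltAct_mul, ← ltAct_mul]
  refine ltAct_genPt_eq_of_dvd_sub hπ ⟨digitSum (π := π) (residueDigit F) e, ?_⟩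
  rw [mul_add, add_sub_cancel_left, ← mul_assoc, ← pow_add, show k + (m + 1 - k) = m + 1 by omega]

/-- **`e ↦ σ_e` is injective** (`[π^{m+1-k} Σ digit(eᵢ) πⁱ] λ` determines `e`, accepted `digits_injective`).
[cite: deShalit1987, Ch. I §2.2 (2)] -/
theorem stabParam_injective (hk : k ≤ m) : Function.Injective (stabParam hπ m u hk) := by
  intro e e' h
  have h1 := congrArg (fun σ => mapPt σ (ltAct hπ m (u : 𝒪[F]) (genPt hπ m))) h
  simp only [mapPt_stabParam_eq_ltAct] at h1
  have h2 := (ltAct_genPt_eq_iff hπ).mp h1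
  rw [add_sub_add_left_eq_sub, ← mul_sub] at h2
  refine digits_injective hπ m (by omega : k ≤ m + 1) ?_
  change ltAct hπ m (π ^ (m + 1 - k) * digitSum (π := π) (residueDigit F) e) (genPt hπ m) =
    ltAct hπ m (π ^ (m + 1 - k) * digitSum (π := π) (residueDigit F) e') (genPt hπ m)
  exact ltAct_genPt_eq_of_dvd_sub hπ (by rwa [← mul_sub])

/-- **`e ↦ σ_e` exhausts the stabiliser of `[π^k] ω`**: if `σ([π^k] ω) = [π^k] ω` then `σ = σ_e` for the
digit vector `e` of `(u_σ - 1) u / π^{m+1-k}` modulo `π^k`. [cite: deShalit1987, Ch. I §2.2 (2)] -/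
theorem exists_stabParam_eq_of_mapPt_eq (hk : k ≤ m) {σ : ltField π m ≃ₐ[F] ltField π m}
    (hσ : mapPt σ (ltAct hπ m (π ^ k) (ltAct hπ m (u : 𝒪[F]) (genPt hπ m))) =
      ltAct hπ m (π ^ k) (ltAct hπ m (u : 𝒪[F]) (genPt hπ m))) :
    ∃ e : Fin k → 𝓀[F], stabParam hπ m u hk e = σ := by
  -- `σ ω = [u_σ u] λ` and `π^{m+1} ∣ π^k u_σ u - π^k u`
  have hσω : mapPt σ (ltAct hπ m (u : 𝒪[F]) (genPt hπ m)) =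
      ltAct hπ m ((ltGalUnit hπ m σ : 𝒪[F]) * u) (genPt hπ m) := by
    rw [mapPt_ltAct, ← ltAct_mul]
  rw [mapPt_ltAct', hσω, ← ltAct_mul, ← ltAct_mul, ltAct_genPt_eq_iff] at hσ
  obtain ⟨c, hc⟩ := hσ
  -- cancel `π^k`: `u_σ u - u = π^{m+1-k} c`
  have hπ0 : (π : 𝒪[F]) ≠ 0 := fun h0 => hπ.ne_zero (by rw [h0]; rfl)
  have hb : (ltGalUnit hπ m σ : 𝒪[F]) * u - u = π ^ (m + 1 - k) * c := by
    have e1 : π ^ k * ((ltGalUnit hπ m σ : 𝒪[F]) * u - u) = π ^ k * (π ^ (m + 1 - k) * c) := by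
      rw [mul_sub, hc, ← mul_assoc, ← pow_add, show k + (m + 1 - k) = m + 1 by omega]
    exact mul_left_cancel₀ (pow_ne_zero k hπ0) e1
  obtain ⟨e, he⟩ := exists_digits hπ k c
  refine ⟨e, algEquiv_eq_of_mapPt_ltAct_eq hπ m u ?_⟩
  rw [mapPt_stabParam_eq_ltAct, hσω]
  refine ltAct_genPt_eq_of_dvd_sub hπ ?_
  -- `u + π^{m+1-k} D_e - u_σ u = π^{m+1-k} (D_e - c)`
  have e2 : (u : 𝒪[F]) + π ^ (m + 1 - k) * digitSum (π := π) (residueDigit F) e -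
      (ltGalUnit hπ m σ : 𝒪[F]) * u = -(π ^ (m + 1 - k) * (c - digitSum (π := π) (residueDigit F) e)) := by
    have : (ltGalUnit hπ m σ : 𝒪[F]) * u = u + π ^ (m + 1 - k) * c := by rw [← hb]; ring
    rw [this]; ring
  rw [e2, dvd_neg]
  obtain ⟨d, hd⟩ := he
  refine ⟨d, ?_⟩
  rw [hd, ← mul_assoc, ← pow_add, show m + 1 - k + k = m + 1 by omega]

/-! ### De Shalit's (2): products over the stabiliser are `𝒩`-iterates -/

/-- **`σ(h(ω)) = h(σ ω)`**: automorphisms commute with evaluation of `𝒪_F`-series (the coefficients are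
fixed and `σ` is continuous). [cite: deShalit1987, Ch. I §2.3 (iv) (proof)] -/
theorem algEquiv_evalAt (σ : ltField π m ≃ₐ[F] ltField π m) (h : PowerSeries (LTCoeff F))
    (x : (maxNilIdeal F (ltField π m)).toIdeal) :
    σ ((evalAt (maxNilIdeal F (ltField π m)) x h : unitBall (ltField π m)) : ltField π m) =
      ((evalAt (maxNilIdeal F (ltField π m)) (mapPt σ x) h : unitBall (ltField π m)) : ltField π m) := by
  rw [← coe_toUnitBallHom σ, algHom_evalAt (maxNilIdeal F (ltField π m)) (maxNilIdeal F (ltField π m))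
    (toUnitBallHom σ) (continuous_toUnitBallHom σ) h x (mapPt σ x) rfl]

open scoped Classical in
/-- ★ **De Shalit's (2), relative form: `∏_{σ : σ[π^k]ω = [π^k]ω} σ(h(ω)) = (𝒩^{(k)} h)([π^k] ω)`** for
`h ∈ 𝒪_F⟦X⟧`, a primitive division point `ω = [u] λ_{m+1}` of `K_π^{m+1}` and `k ≤ m`: the norm of
`h(ω)` from `K_π^{m+1}` to `K_π^{m+1-k} = F([π^k]ω)` (the product over `Gal(K_π^{m+1}/F([π^k]ω))`, the
stabiliser of `[π^k]ω`) is the value of the `k`-th Coleman norm iterate at `[π^k] ω`.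
[cite: deShalit1987, Ch. I §2.2 (2)] -/
theorem prod_stabilizer_algEquiv_evalAt (hk : k ≤ m) (h : PowerSeries (LTCoeff F)) :
    ∏ σ ∈ Finset.univ.filter (fun σ : ltField π m ≃ₐ[F] ltField π m =>
        mapPt σ (ltAct hπ m (π ^ k) (ltAct hπ m (u : 𝒪[F]) (genPt hπ m))) =
          ltAct hπ m (π ^ k) (ltAct hπ m (u : 𝒪[F]) (genPt hπ m))),
      σ ((evalAt (maxNilIdeal F (ltField π m)) (ltAct hπ m (u : 𝒪[F]) (genPt hπ m)) h :
        unitBall (ltField π m)) : ltField π m) =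
      ((evalAt (maxNilIdeal F (ltField π m)) (ltAct hπ m (π ^ k) (ltAct hπ m (u : 𝒪[F]) (genPt hπ m)))
        (colemanNormIter hπ m k h) : unitBall (ltField π m)) : ltField π m) := by
  classical
  -- right-hand side: the Coleman product over `W_f^k`
  have hrhs := evalAt_ltSMul_pow_colemanNormIter hπ m k (by omega) h (ltAct hπ m (u : 𝒪[F]) (genPt hπ m))
  rw [← map_pow] at hrhs
  change evalAt (maxNilIdeal F (ltField π m)) (ltAct hπ m (π ^ k) (ltAct hπ m (u : 𝒪[F]) (genPt hπ m)))
      (colemanNormIter hπ m k h) = ∏ d : Fin k → 𝓀[F], evalAt (maxNilIdeal F (ltField π m))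
        (ltAdd (maxNilIdeal F (ltField π m)) (isLTRing_LTCoeff hπ) (isLTSeries_LTCoeff π)
          (ltAct hπ m (u : 𝒪[F]) (genPt hπ m))
          (ltAct hπ m (π ^ (m + 1 - k) * digitSum (π := π) (residueDigit F) d) (genPt hπ m))) h at hrhs
  rw [hrhs, SubmonoidClass.coe_finsetProd]
  -- left-hand side: reparametrise the stabiliser by `e ↦ σ_e`
  symm
  refine Finset.prod_bij (fun e _ => stabParam hπ m u hk e) (fun e _ => ?_) (fun e₁ _ e₂ _ h12 => ?_)
    (fun σ hσ => ?_) (fun e _ => ?_)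
  · rw [Finset.mem_filter]
    exact ⟨Finset.mem_univ _, mapPt_stabParam_ltAct_pow hπ m u hk e⟩
  · exact stabParam_injective hπ m u hk h12
  · rw [Finset.mem_filter] at hσ
    obtain ⟨e, he⟩ := exists_stabParam_eq_of_mapPt_eq hπ m u hk hσ.2
    exact ⟨e, Finset.mem_univ _, he⟩
  · rw [algEquiv_evalAt, mapPt_stabParam]

open scoped Classical in
/-- **Norm-coherence of the values of an `𝒩`-invariant series** (de Shalit I §2.2 (2) with Cor. 2.3 (ii)):
if `𝒩h = h` then `∏_{σ : σ[π^k]ω = [π^k]ω} σ(h(ω)) = h([π^k] ω)` — the norm of `h(ω_{m+1})` down to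
`K_π^{m+1-k}` is `h(ω_{m+1-k})`. [cite: deShalit1987, Ch. I §2.3 (ii)] -/
theorem prod_stabilizer_algEquiv_evalAt_of_colemanNorm_eq (hk : k ≤ m) {h : PowerSeries (LTCoeff F)}
    (hh : colemanNorm hπ m h = h) :
    ∏ σ ∈ Finset.univ.filter (fun σ : ltField π m ≃ₐ[F] ltField π m =>
        mapPt σ (ltAct hπ m (π ^ k) (ltAct hπ m (u : 𝒪[F]) (genPt hπ m))) =
          ltAct hπ m (π ^ k) (ltAct hπ m (u : 𝒪[F]) (genPt hπ m))),
      σ ((evalAt (maxNilIdeal F (ltField π m)) (ltAct hπ m (u : 𝒪[F]) (genPt hπ m)) h :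
        unitBall (ltField π m)) : ltField π m) =
      ((evalAt (maxNilIdeal F (ltField π m)) (ltAct hπ m (π ^ k) (ltAct hπ m (u : 𝒪[F]) (genPt hπ m))) h :
        unitBall (ltField π m)) : ltField π m) := by
  have hiter : colemanNormIter hπ m k h = h := by
    rw [colemanNormIter]
    exact Function.iterate_fixed hh k
  rw [prod_stabilizer_algEquiv_evalAt hπ m u hk h, hiter]

end LocalFieldNC

end Literature.NumberTheory.GaloisRepresentations
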